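import Literature.MathematicalPhysics.QuantumFieldTheory.Balaban1983to89.B9Eq3126H1BoundTowerVariational
import Literature.MathematicalPhysics.QuantumFieldTheory.Balaban1983to89.B9Eq3124GaugeModes
import Literature.MathematicalPhysics.QuantumFieldTheory.Balaban1983to89.B9Eq326OperatorSymmetric

/-!
# `Balaban1983to89.B9Eq3126QG1QLowerDiagonalClosed` — T. Bałaban, *Propagators for lattice gauge theories in a background field*, Commun. Math. Phys.
# **99** (1985) 389–434 [Balaban1985BackgroundPropagators] (3.126) p. 420, (3.26) p. 395, Thm 3.11 p. 416, (3.79) p. 406, with T. Bałaban, *The variational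
# problem and background fields in renormalization group method for lattice gauge theories*, Commun. Math. Phys. **102** (1985) 277–309 [Balaban1985Variational]
# (45)–(46) p. 285 («`QG₁Q*` … is invertible», «B₀ … uniform») and [Balaban1984PropagatorsII] (2.77) p. 236 (`⟨ω₁, Q_jG_jQ_j*ω₁⟩ ≥ γ₀‖ω₁‖²`, «γ₀ is a
# positive, absolute constant»): **THE LETTER `μ₁` OF ROAD ΔA-CT — `μ₁‖g‖² ≤ re⟪g, Q_kG₁,k(U)Q_k†g⟫` — IS A THEOREM ON PRINT's DIAGONAL AT EVERY HEIGHT, CLOSED: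
# `∃ α₀ μ₁ > 0` (closed in `(d, a, L, M_φ, M_φ′, r, C_τ, ρ_w)`) BEFORE every height `n`, lattice, weights and background in the small-field windows** —
# ne9-leaf-02's closed `K`-letter `‖(Q_kG_kQ_k†)⁻¹y‖ ≤ C_K‖y‖` (`B9Eq3126H1BoundTowerVariational.exists_norm_KinvLatticeK_H1LatticeK_le_diagonal_closed`, the
# end-point of their variational bond-tent programme) turned into the FORM floor `re⟪g, Kg⟫ ≥ (1∕C_K)‖g‖²` that the crew's `H₁` rows display as `hX1`
# (`B9Eq3126ConjugatedQG1QInvTower`, `B9Eq3126QG1QInvPointDecayTower`, `B9Eq3126H1BlockDecayTower`, the OWNER's `B9Eq3126H1BlockDecayTowerClosed`,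
# `B9Eq3126H1BlockDecayUniformRadiusTower`), by the [folklore] discriminant step for a symmetric positive `K` with a bounded inverse

statement-level skeleton of published theorems with citation tags; proofs where landed; nothing here is a claim about the Yang–Mills mass gap

CITATION HEADER (lean-in-tree rule).  Audit cell `pub-balaban`, sub-cell `t4`, BINDER row NE9 (road ΔA-CT of the NE9 formalisation swarm, leaf prover 03
`b2b-balaban-t4-ne9-formalise-leaf-03` gen 77).  Imports BY NAME (all BUILT): ne9-leaf-02's `B9Eq3126H1BoundTowerVariational`
(`exists_norm_KinvLatticeK_H1LatticeK_le_diagonal_closed`), the OWNER's `B9Eq3124GaugeModes` (`greenK_isSymmetric`) and `B9Eq326OperatorSymmetric`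
(`laplaceAofU_isSymmetric`; through the first import `B9Eq326OperatorTower.{QkW, laplaceAk, G1k, laplaceAk_isSymmetric}`, `B11Eq103H1Complex.{greenK,
KinvLatticeK, hK_lattice}`).  Sources READ first-hand: [Balaban1985BackgroundPropagators] (`paper:balaban1985-cmp99-background-propagators`, journal page = PDF
page + 388) p. 420 (3.126), p. 395 (3.26), p. 416 Thm 3.11, p. 406 (3.79); [Balaban1985Variational] p. 285 (45)–(46); [Balaban1984PropagatorsII]
(`paper:balaban1984-cmp96-propagators-rt-ii`) p. 236 (2.74)–(2.77).  Print obtains the floor of `Q_jG_jQ_j*` from the Fourier representation of [B5] at the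
flat point ((2.75)–(2.76)); the cell's floor is ne9-leaf-02's variational one (ONE bond-tent test family); this file only converts their operator-norm letter
of the INVERSE into the quadratic-form letter the decay rows consume — nothing of print's `γ₀` asserted or valued.

WHAT IS PROVED (sorry-free; proof lane — no `def`; [folklore] Hilbert-space algebra + composition BY NAME).
* §1 (abstract, `RCLike`) `re_inner_QGQadj_self_nonneg` (`0 ≤ re⟪y, QGQ†y⟫`), `inner_QGQadj_symm` (`⟪QGQ†u, v⟫ = ⟪u, QGQ†v⟫`),
  **`re_inner_QGQadj_ge_of_inverse_bound`**: `T` symmetric positive definite, `G = T⁻¹` (`B11Eq103H1Complex.greenK`), `Q : E →ₗ F`, ANY map `Kinv : F → F` with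
  `Q(G(Q†(Kinv y))) = y` and `‖Kinv y‖ ≤ C_K‖y‖` (`C_K > 0`) ⟹ `(1∕C_K)‖y‖² ≤ re⟪y, Q(G(Q†y))⟫` (discriminant of `t ↦ re⟪y − tKinv y, K(y − tKinv y)⟫ ≥ 0` at
  `t = 1∕C_K`).
* §2 **`re_inner_QG1ofUQadj_ge_of_inverse_bound`** (one-step torus, `Δ_a(U)` of `B9Eq326OperatorAssembly` at EVERY background with unitary `U`, `*`-trace,
  compatible normings, ANY averaging `Q` and ANY bounded inverse of `QG₁(U)Q†`): `hX1` of `B9Eq3126ConjugatedQG1QInv` ∕ `B9Eq3126QG1QInvPointDecay` ∕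
  `B9Eq3126H1BlockDecay` at `μ₁ := 1∕C_K`.
* §3 **`re_inner_QkG1kQadj_ge_of_KinvLatticeK_bound`** (tower `towerP L m (n+1)`, every height): `‖(Q_kG₁,kQ_k†)⁻¹y‖ ≤ C_K‖y‖` for the CONSTRUCTED inverse
  `B11Eq103H1Complex.KinvLatticeK` ⟹ `(1∕C_K)‖g‖² ≤ re⟪g, Q_k(U)(G₁,k(U)(Q_k(U)†g))⟫` — `hX1` of the tower rows VERBATIM at `μ₁ := 1∕C_K`.
* §4 **`exists_X1_floor_diagonal_closed`** — THE CLOSED LETTER: `∃ α₀ μ₁ > 0` such that for every `n` (`3 ≤ L^{n+1}`), `η` (`ηL^{n+1} = 1`), `c₀, c₁`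
  (`c₀(L^{n+1})^d = c₁`, `|η|^d∕c₀ ≤ ρ_w`), `m`, every background `U` of E162's data, unitary, `U(b) ∈ U1`, in the windows `‖U(b) − 1‖ ≤ αη`,
  `‖U(∂p) − 1‖ ≤ αη²`, `‖Ū^j − 1‖ ≤ ε_j ≤ αr^j`, `0 ≤ α ≤ α₀`, ANY `hpos` and `Q_k(U)` onto: `μ₁‖g‖² ≤ re⟪g, Q_k(U)(G₁,k(U)(Q_k(U)†g))⟫` for every `g`
  (`μ₁ = 1∕C_K` of ne9-leaf-02, closed in `(d, a, L, M_φ, M_φ′, r, C_τ, ρ_w)`; NO height, NO lattice spacing, NO volume, NO operator bound).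
HONEST SCOPE.  [folklore] algebra + ONE composition; the windows, `1 ≤ d`, `a > 0`, `r < 1`, the bounded `*`-trace compatible with the Hilbert norming and
`|η|^d∕c₀ ≤ ρ_w` are ne9-leaf-02's ∕ the OWNER's letters VERBATIM; the constant is crude (theirs); NOT print's `γ₀` of (2.77), NOT a kernel bound; NOT NE9 (cell
pub-balaban: NE9 NOT PRINTED ∕ NOT PROVED; «NE9 ⇐ the named binders»; row WALLED ON A MODEL (O-NE9-1; #5 UNRULED); spine PROVED 0∕9; rung (B)+1 on a finite T⁴ — NOT
infinite volume, NOT mass gap, NOT BetaPertH, NOT Clay; HONEST DEPENDENCY: continuum YM on T⁴ ⇐ BetaPertH ∧ nine spine estimates (0/9 proved); BetaPertH ⇐ (D1) ∧ (D4)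
∧ CAP+tail; G-an2-4 gates asym, D1 and NE2/3/4).  NEW file; nothing modified.  Net new unproved facts: 0.
-/

noncomputable section

open scoped InnerProductSpace ComplexConjugate

namespace Literature.MathematicalPhysics.QuantumFieldTheory.Balaban1983to89.B9Eq3126QG1QLowerDiagonalClosed

open B4Sect5Torus (TSite)
open B9SectCLatticeCarrier (Bond)
open B9Eq319QprimeTorus (fineP)
open B11Eq103H1Complex (BondL2K greenK apply_greenK re_inner_greenK_pos KinvLatticeK hK_lattice)
open B9Eq3124GaugeModes (greenK_isSymmetric)
open B9Eq310HessianOperator (adTransportW)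
open B9Eq310DeltaPrime (plaqHolU)
open B9Eq326OperatorAssembly (laplaceAofU G1ofU)
open B9Eq326OperatorSymmetric (laplaceAofU_isSymmetric)
open B9Eq315QTower (towerP UlevOf)
open B9Eq315QTorus (perCfg cornerSite)
open B7Prop1Explicit (Wcx boxVec U1)
open B9Eq326OperatorTower (laplaceAk G1k QkW laplaceAk_isSymmetric)
open B9Eq3126H1BoundTowerVariational (exists_norm_KinvLatticeK_H1LatticeK_le_diagonal_closed)

/-! ## §1 A symmetric positive `K = QGQ†` with a bounded inverse is bounded below as a form (abstract, `RCLike`) -/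

section Abstract

variable {𝕜 : Type*} [RCLike 𝕜] {E : Type*} [NormedAddCommGroup E] [InnerProductSpace 𝕜 E] [FiniteDimensional 𝕜 E]
  {F : Type*} [NormedAddCommGroup F] [InnerProductSpace 𝕜 F] [FiniteDimensional 𝕜 F]
  {T : E →ₗ[𝕜] E} (hTs : T.IsSymmetric) (hpos : ∀ x : E, x ≠ 0 → 0 < RCLike.re ⟪x, T x⟫_𝕜)

/-- `K = QGQ†` is a nonnegative form: `0 ≤ re⟪y, Q(G(Q†y))⟫` (`= re⟪Q†y, G(Q†y)⟫`, `G = T⁻¹` positive). [folklore]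
[cite: Balaban1985BackgroundPropagators, Thm 3.11 p.416; Balaban1985Variational, (45) p.285] -/
theorem re_inner_QGQadj_self_nonneg (Q : E →ₗ[𝕜] F) (y : F) :
    0 ≤ RCLike.re ⟪y, Q (greenK T hpos (LinearMap.adjoint Q y))⟫_𝕜 := by
  rw [← LinearMap.adjoint_inner_left]
  by_cases h : LinearMap.adjoint Q y = 0
  · rw [h, inner_zero_left, map_zero]
  · exact (re_inner_greenK_pos hpos _ h).le

include hTs in
/-- `K = QGQ†` is symmetric when `T` is: `⟪Q(G(Q†u)), v⟫ = ⟪u, Q(G(Q†v))⟫`. [folklore] [cite: Balaban1985Variational, p.293, (45) p.285] -/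
theorem inner_QGQadj_symm (Q : E →ₗ[𝕜] F) (u v : F) :
    ⟪Q (greenK T hpos (LinearMap.adjoint Q u)), v⟫_𝕜 = ⟪u, Q (greenK T hpos (LinearMap.adjoint Q v))⟫_𝕜 := by
  rw [← LinearMap.adjoint_inner_right, greenK_isSymmetric hpos hTs, LinearMap.adjoint_inner_left]

include hTs in
/-- **`QGQ† ≥ 1∕C_K` FROM A BOUNDED INVERSE**: `T` symmetric positive definite with Green operator `G = T⁻¹`, `Q : E →ₗ F`, ANY map `Kinv : F → F` with
`Q(G(Q†(Kinv y))) = y` and `‖Kinv y‖ ≤ C_K‖y‖` (`C_K > 0`) ⟹ `(1∕C_K)‖y‖² ≤ re⟪y, Q(G(Q†y))⟫` — the discriminant of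
`0 ≤ re⟪y − t·Kinv y, K(y − t·Kinv y)⟫ = re⟪y, Ky⟫ − 2t‖y‖² + t²re⟪Kinv y, y⟫` at `t = 1∕C_K`, with `re⟪Kinv y, y⟫ ≤ C_K‖y‖²`.
[folklore] [cite: Balaban1985Variational, (45)–(46) p.285; Balaban1985BackgroundPropagators, (3.126) p.420, Thm 3.11 p.416; Balaban1984PropagatorsII, (2.77) p.236] -/
theorem re_inner_QGQadj_ge_of_inverse_bound (Q : E →ₗ[𝕜] F) (Kinv : F → F) {CK : ℝ} (hCK : 0 < CK)
    (hK : ∀ y, Q (greenK T hpos (LinearMap.adjoint Q (Kinv y))) = y) (hKb : ∀ y, ‖Kinv y‖ ≤ CK * ‖y‖) (y : F) :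
    1 / CK * ‖y‖ ^ 2 ≤ RCLike.re ⟪y, Q (greenK T hpos (LinearMap.adjoint Q y))⟫_𝕜 := by
  set K : F →ₗ[𝕜] F := Q ∘ₗ greenK T hpos ∘ₗ LinearMap.adjoint Q with hKdef
  have hKapp : ∀ u, K u = Q (greenK T hpos (LinearMap.adjoint Q u)) := fun u => rfl
  set w := Kinv y with hw
  have hKw : K w = y := by rw [hKapp]; exact hK y
  -- `⟪w, Ky⟫ = ⟪Kw, y⟫ = ⟪y, y⟫`
  have hwKy : ⟪w, K y⟫_𝕜 = ⟪y, y⟫_𝕜 := by rw [hKapp, ← inner_QGQadj_symm hTs hpos Q w y, ← hKapp, hKw]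
  set t : ℝ := 1 / CK with ht
  -- the discriminant vector
  have h0 : 0 ≤ RCLike.re ⟪y - (t : 𝕜) • w, K (y - (t : 𝕜) • w)⟫_𝕜 := by rw [hKapp]; exact re_inner_QGQadj_self_nonneg hpos Q _
  have hexp : ⟪y - (t : 𝕜) • w, K (y - (t : 𝕜) • w)⟫_𝕜 =
      ⟪y, K y⟫_𝕜 - (t : 𝕜) * ⟪y, y⟫_𝕜 - (t : 𝕜) * ⟪y, y⟫_𝕜 + ((t * t : ℝ) : 𝕜) * ⟪w, y⟫_𝕜 := by
    simp only [map_sub, map_smul, hKw, inner_sub_left, inner_sub_right, inner_smul_left, inner_smul_right, RCLike.conj_ofReal, hwKy]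
    push_cast
    ring
  have hre : RCLike.re ⟪y - (t : 𝕜) • w, K (y - (t : 𝕜) • w)⟫_𝕜 =
      RCLike.re ⟪y, K y⟫_𝕜 - t * ‖y‖ ^ 2 - t * ‖y‖ ^ 2 + t * t * RCLike.re ⟪w, y⟫_𝕜 := by
    rw [hexp, map_add, map_sub, map_sub, RCLike.re_ofReal_mul, RCLike.re_ofReal_mul, inner_self_eq_norm_sq (𝕜 := 𝕜)]
  -- `re⟪w, y⟫ ≤ C_K‖y‖²`
  have hwy : RCLike.re ⟪w, y⟫_𝕜 ≤ CK * ‖y‖ ^ 2 :=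
    calc RCLike.re ⟪w, y⟫_𝕜 ≤ ‖w‖ * ‖y‖ := (RCLike.re_le_norm _).trans (norm_inner_le_norm _ _)
      _ ≤ CK * ‖y‖ * ‖y‖ := mul_le_mul_of_nonneg_right (hKb y) (norm_nonneg _)
      _ = CK * ‖y‖ ^ 2 := by ring
  have ht0 : 0 ≤ t := by positivity
  have htt : t * t * RCLike.re ⟪w, y⟫_𝕜 ≤ t * ‖y‖ ^ 2 :=
    calc t * t * RCLike.re ⟪w, y⟫_𝕜 ≤ t * t * (CK * ‖y‖ ^ 2) := mul_le_mul_of_nonneg_left hwy (mul_nonneg ht0 ht0)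
      _ = t * ‖y‖ ^ 2 := by rw [ht]; field_simp
  rw [hre] at h0
  rw [← hKapp]
  linarith

end Abstract

/-! ## §2 One step: `μ₁ := 1∕C_K` for `QG₁(U)Q†` at the assembled `Δ_a(U)` from ANY bounded inverse -/

section Lattice

variable {d : ℕ} (L : ℕ) [NeZero L] (m : Fin d → ℕ) {𝔸 : Type*} [Ring 𝔸] [StarRing 𝔸] [Algebra ℂ 𝔸] [StarModule ℂ 𝔸]
  {W : Type*} [NormedAddCommGroup W] [InnerProductSpace ℂ W] [FiniteDimensional ℂ W] (φ : W ≃ₗ[ℂ] 𝔸) {c₀ : ℝ} [Fact (0 < c₀)]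
  (τ : 𝔸 →ₗ[ℂ] ℂ) (η : ℝ) {U : Bond d (fineP L m) → 𝔸ˣ} {F : Type*} [NormedAddCommGroup F] [InnerProductSpace ℂ F] [FiniteDimensional ℂ F]

/-- **ONE STEP — `hX1` AT `μ₁ := 1∕C_K` FROM ANY BOUNDED INVERSE OF `QG₁(U)Q†`**: on the one-step torus, for a unitary background, a `*`-trace and
compatible normings (`Δ_a(U)` symmetric — `B9Eq326OperatorSymmetric`), the displayed positivity `hpos` (Thm 3.11), ANY averaging `Q` and ANY map `Kinv`
with `Q(G₁(U)(Q†(Kinv y))) = y`, `‖Kinv y‖ ≤ C_K‖y‖` (`C_K > 0`): `(1∕C_K)·‖g‖² ≤ re⟪g, Q(G₁(U)(Q†g))⟫` — the hypothesis `hX1` of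
`B9Eq3126ConjugatedQG1QInv` ∕ `B9Eq3126QG1QInvPointDecay` ∕ `B9Eq3126H1BlockDecay` at `μ₁ := 1∕C_K`.
[cite: Balaban1985BackgroundPropagators, (3.126) p.420, (3.26) p.395, Thm 3.11 p.416; Balaban1985Variational, (45) p.285; Balaban1984PropagatorsII, (2.77) p.236] -/
theorem re_inner_QG1ofUQadj_ge_of_inverse_bound (hU : ∀ b, star (U b : 𝔸) = ((U b)⁻¹ : 𝔸ˣ)) (hτ₁ : ∀ X : 𝔸, τ (star X) = conj (τ X))
    (hτ₂ : ∀ X Y : 𝔸, τ (X * Y) = τ (Y * X)) (hφ : ∀ X Y : 𝔸, ⟪φ.symm X, φ.symm Y⟫_ℂ = τ (star X * Y))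
    (Q : BondL2K ℂ d (fineP L m) c₀ W →ₗ[ℂ] F) (a : ℝ)
    (hpos : ∀ x : BondL2K ℂ d (fineP L m) c₀ W, x ≠ 0 → 0 < RCLike.re ⟪x, laplaceAofU L m φ η U τ Q a x⟫_ℂ)
    (Kinv : F → F) {CK : ℝ} (hCK : 0 < CK) (hK : ∀ y, Q (G1ofU L m φ η U τ hpos (LinearMap.adjoint Q (Kinv y))) = y)
    (hKb : ∀ y, ‖Kinv y‖ ≤ CK * ‖y‖) (g : F) :
    1 / CK * ‖g‖ ^ 2 ≤ RCLike.re ⟪g, Q (G1ofU L m φ η U τ hpos (LinearMap.adjoint Q g))⟫_ℂ :=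
  re_inner_QGQadj_ge_of_inverse_bound (laplaceAofU_isSymmetric L m φ τ η hU hτ₁ hτ₂ hφ Q a) hpos Q Kinv hCK hK hKb g

end Lattice

/-! ## §3 The tower: `μ₁ := 1∕C_K` for `Q_kG₁,k(U)Q_k†` at every height from a bound of the constructed `(Q_kG₁,kQ_k†)⁻¹` -/

section Tower

variable {d : ℕ} (L : ℕ) [NeZero L] (m : Fin d → ℕ) [∀ i, NeZero (m i)] (n : ℕ) {𝔸 : Type*} [NormedRing 𝔸] [StarRing 𝔸] [NormedAlgebra ℂ 𝔸]
  [StarModule ℂ 𝔸] [CompleteSpace 𝔸] [NormOneClass 𝔸]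
  {W : Type*} [NormedAddCommGroup W] [InnerProductSpace ℂ W] [FiniteDimensional ℂ W] (φ : W ≃ₗ[ℂ] 𝔸) {c₀ c₁ : ℝ} [Fact (0 < c₀)] [Fact (0 < c₁)]
  (η : ℝ) (U : Bond d (towerP L m (n + 1)) → 𝔸ˣ) (hL : 1 ≤ L) (α : ℕ → ℝ) (hα1 : ∀ j, α j ≤ 1 / 64)
  (hU1 : ∀ (j : ℕ) (x : B7Prop1Explicit.Site d) (κ : Fin d), perCfg (towerP L m (j + 1)) (B9Eq315QTower.UlevOf L m (n + 1) U j) x κ ∈ U1 𝔸)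
  (hreg : ∀ (j : ℕ) (y : TSite d (towerP L m j)) (κ : Fin d) (r : Fin d → Fin L),
    ‖((Wcx L (perCfg (towerP L m (j + 1)) (B9Eq315QTower.UlevOf L m (n + 1) U j)) (cornerSite L y) κ (boxVec L r) : 𝔸ˣ) : 𝔸) - 1‖ ≤ α j)
  (τ : 𝔸 →ₗ[ℂ] ℂ)

/-- **THE TOWER — `hX1` AT `μ₁ := 1∕C_K` FROM A BOUND OF THE CONSTRUCTED INVERSE `(Q_kG₁,kQ_k†)⁻¹ = KinvLatticeK`**: for a unitary background on
`towerP L m (n+1)`, a `*`-trace and compatible normings (`laplaceAk_isSymmetric`), the displayed positivity of `Δ_{a,k}(U)`, `Q_k(U)` onto, and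
`‖(Q_kG₁,kQ_k†)⁻¹y‖ ≤ C_K‖y‖` (`C_K > 0`): `(1∕C_K)·‖g‖² ≤ re⟪g, Q_k(U)(G₁,k(U)(Q_k(U)†g))⟫` for every `g`, every height `n` — the `hX1` of
`B9Eq3126ConjugatedQG1QInvTower` ∕ `B9Eq3126QG1QInvPointDecayTower` ∕ `B9Eq3126H1BlockDecayTower` ∕ `B9Eq3126H1BlockDecayUniformRadiusTower` VERBATIM.
[cite: Balaban1985BackgroundPropagators, (3.126) p.420, (3.26) p.395, (3.15) p.393, Thm 3.11 p.416; Balaban1985Variational, (45)–(46) p.285; Balaban1984PropagatorsII, (2.77) p.236] -/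
theorem re_inner_QkG1kQadj_ge_of_KinvLatticeK_bound (hU : ∀ b, star (U b : 𝔸) = ((U b)⁻¹ : 𝔸ˣ)) (hτ₁ : ∀ X : 𝔸, τ (star X) = conj (τ X))
    (hτ₂ : ∀ X Y : 𝔸, τ (X * Y) = τ (Y * X)) (hφ : ∀ X Y : 𝔸, ⟪φ.symm X, φ.symm Y⟫_ℂ = τ (star X * Y)) (a : ℝ)
    (hpos : ∀ x : BondL2K ℂ d (towerP L m (n + 1)) c₀ W, x ≠ 0 →
      0 < RCLike.re ⟪x, laplaceAk L m n φ η U hL α hα1 hU1 hreg τ (c₀ := c₀) (c₁ := c₁) a x⟫_ℂ)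
    (hQ : Function.Surjective (QkW L m n φ U hL α hα1 hU1 hreg (c₀ := c₀) (c₁ := c₁))) {CK : ℝ} (hCK : 0 < CK)
    (hKb : ∀ y : BondL2K ℂ d m c₁ W, ‖KinvLatticeK hpos hQ y‖ ≤ CK * ‖y‖) (g : BondL2K ℂ d m c₁ W) :
    1 / CK * ‖g‖ ^ 2 ≤ RCLike.re ⟪g, QkW L m n φ U hL α hα1 hU1 hreg (c₀ := c₀) (c₁ := c₁)
      (G1k L m n φ η U hL α hα1 hU1 hreg τ (c₀ := c₀) (c₁ := c₁) hpos
        (LinearMap.adjoint (QkW L m n φ U hL α hα1 hU1 hreg (c₀ := c₀) (c₁ := c₁)) g))⟫_ℂ :=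
  re_inner_QGQadj_ge_of_inverse_bound (laplaceAk_isSymmetric L m n φ η U hL α hα1 hU1 hreg τ hU hτ₁ hτ₂ hφ a) hpos _ (KinvLatticeK hpos hQ) hCK
    (hK_lattice hpos hQ) hKb g

end Tower

/-! ## §4 THE CLOSED LETTER: `∃ α₀ μ₁ > 0` before every height, lattice and background in the windows (print's diagonal) -/

section Closed

variable {d : ℕ} (hd : 1 ≤ d) (L : ℕ) [NeZero L] (hL : 1 ≤ L)
  {𝔸 : Type*} [NormedRing 𝔸] [NormedAlgebra ℂ 𝔸] [CompleteSpace 𝔸] [NormOneClass 𝔸] [StarRing 𝔸] [NormedStarGroup 𝔸] [StarModule ℂ 𝔸]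
  {W : Type*} [NormedAddCommGroup W] [InnerProductSpace ℂ W] [FiniteDimensional ℂ W] (φ : W ≃ₗ[ℂ] 𝔸)
  {Mφ Mφ' : ℝ} (hMφ : 0 ≤ Mφ) (hMφ' : 0 ≤ Mφ') (hφ : ∀ w, ‖φ w‖ ≤ Mφ * ‖w‖) (hφ' : ∀ X, ‖φ.symm X‖ ≤ Mφ' * ‖X‖)
  {a : ℝ} (ha : 0 < a) {r : ℝ} (hr0 : 0 ≤ r) (hr1 : r < 1)
  (τ : 𝔸 →ₗ[ℂ] ℂ) {Cτ : ℝ} (hτ : ∀ X, ‖τ X‖ ≤ Cτ * ‖X‖) (hCτ : 0 ≤ Cτ) {ρw : ℝ} (hρw : 0 ≤ ρw)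
  (hτ₁ : ∀ X : 𝔸, τ (star X) = conj (τ X)) (hτ₂ : ∀ X Y : 𝔸, τ (X * Y) = τ (Y * X))
  (hφτ : ∀ X Y : 𝔸, ⟪φ.symm X, φ.symm Y⟫_ℂ = τ (star X * Y))

include hd hMφ hMφ' hφ hφ' ha hr0 hr1 hτ hCτ hρw hτ₁ hτ₂ hφτ in
/-- **THE LETTER `μ₁` ([B11] (45), [B6] (2.77)) IS A THEOREM ON THE DIAGONAL AT EVERY HEIGHT — CLOSED FORM.**  There are `α₀, μ₁ > 0`, closed in
`(d, a, L, M_φ, M_φ′, r, C_τ, ρ_w)` (`μ₁ = 1∕C_K` of `B9Eq3126H1BoundTowerVariational`), such that for every `n` (`3 ≤ L^{n+1}`), `η` (`ηL^{n+1} = 1`), `c₀, c₁`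
(`c₀(L^{n+1})^d = c₁`, `|η|^d∕c₀ ≤ ρ_w`), `m`, every background `U` of E162's data which is unitary, `U(b) ∈ U1`, in the windows `‖U(b) − 1‖ ≤ αη`,
`‖U(∂p) − 1‖ ≤ αη²`, `‖Ū^j(b) − 1‖ ≤ ε_j ≤ αr^j` with `0 ≤ α ≤ α₀`, ANY positivity witness `hpos` of `Δ_{a,k}(U)` and `Q_k(U)` onto:
`μ₁‖g‖² ≤ re⟪g, Q_k(U)(G₁,k(U)(Q_k(U)†g))⟫` for every `g` — the `hX1` binder of the crew's `H₁,k` rows INHABITED uniformly in the height.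
[cite: Balaban1985Variational, (45)–(46) p.285; Balaban1985BackgroundPropagators, (3.126) p.420, Thm 3.11 p.416, (3.79) p.406; Balaban1984PropagatorsII, (2.77) p.236] -/
theorem exists_X1_floor_diagonal_closed :
    ∃ α₀ μ₁ : ℝ, 0 < α₀ ∧ 0 < μ₁ ∧ ∀ (n : ℕ) (η : ℝ), η * (L : ℝ) ^ (n + 1) = 1 → 3 ≤ L ^ (n + 1) →
      ∀ (c₀ c₁ : ℝ) [Fact (0 < c₀)] [Fact (0 < c₁)], c₀ * ((L : ℝ) ^ (n + 1)) ^ d = c₁ → |η| ^ d / c₀ ≤ ρw →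
      ∀ (m : Fin d → ℕ) [∀ i, NeZero (m i)] (U : Bond d (towerP L m (n + 1)) → 𝔸ˣ) (αU : ℕ → ℝ) (hα1 : ∀ j, αU j ≤ 1 / 64)
        (hU1 : ∀ (j : ℕ) (x : B7Prop1Explicit.Site d) (κ : Fin d), perCfg (towerP L m (j + 1)) (UlevOf L m (n + 1) U j) x κ ∈ U1 𝔸)
        (hreg : ∀ (j : ℕ) (y : TSite d (towerP L m j)) (κ : Fin d) (r : Fin d → Fin L),
          ‖((Wcx L (perCfg (towerP L m (j + 1)) (UlevOf L m (n + 1) U j)) (cornerSite L y) κ (boxVec L r) : 𝔸ˣ) : 𝔸) - 1‖ ≤ αU j)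
        (εU : ℕ → ℝ), (∀ j, 0 ≤ εU j) → (∀ (j : ℕ) (b : Bond d (towerP L m (j + 1))), ‖(UlevOf L m (n + 1) U j b : 𝔸) - 1‖ ≤ εU j) →
      ∀ {α : ℝ}, 0 ≤ α → α ≤ α₀ →
        (∀ b, star (U b : 𝔸) = (((U b)⁻¹ : 𝔸ˣ) : 𝔸)) →
        (∀ b, U b ∈ U1 𝔸) → (∀ b, ‖(U b : 𝔸) - 1‖ ≤ α * η) →
        (∀ p : B9SectCLatticeCarrier.Plaq d (towerP L m (n + 1)), ‖(plaqHolU U p : 𝔸) - 1‖ ≤ α * η ^ 2) →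
        (∀ j < n + 1, εU j ≤ α * r ^ j) →
        ∀ (hpos : ∀ x : BondL2K ℂ d (towerP L m (n + 1)) c₀ W, x ≠ 0 →
            0 < RCLike.re ⟪x, laplaceAk L m n φ η U hL αU hα1 hU1 hreg τ (c₀ := c₀) (c₁ := c₁) a x⟫_ℂ)
          (hQ : Function.Surjective (QkW L m n φ U hL αU hα1 hU1 hreg (c₀ := c₀) (c₁ := c₁))) (g : BondL2K ℂ d m c₁ W),
          μ₁ * ‖g‖ ^ 2 ≤ RCLike.re ⟪g, QkW L m n φ U hL αU hα1 hU1 hreg (c₀ := c₀) (c₁ := c₁)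
            (G1k L m n φ η U hL αU hα1 hU1 hreg τ (c₀ := c₀) (c₁ := c₁) hpos
              (LinearMap.adjoint (QkW L m n φ U hL αU hα1 hU1 hreg (c₀ := c₀) (c₁ := c₁)) g))⟫_ℂ := by
  obtain ⟨α₀, CK, CH, hα₀, hCK, -, H⟩ :=
    exists_norm_KinvLatticeK_H1LatticeK_le_diagonal_closed hd L hL φ hMφ hMφ' hφ hφ' ha hr0 hr1 τ hτ hCτ hρw hτ₁ hτ₂ hφτ
  refine ⟨α₀, 1 / CK, hα₀, by positivity, ?_⟩
  intro n η hηL hL3 c₀ c₁ _ _ hw hρ m _ U αU hα1 hU1 hreg εU hεU hUε α hα0 hαle hUst hUb hUη hpl hεg hpos hQ g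
  have hKb := (H n η hηL hL3 c₀ c₁ hw hρ m U αU hα1 hU1 hreg εU hεU hUε hα0 hαle hUst hUb hUη hpl hεg hpos hQ).1
  exact re_inner_QkG1kQadj_ge_of_KinvLatticeK_bound L m n φ η U hL αU hα1 hU1 hreg τ hUst hτ₁ hτ₂ hφτ a hpos hQ hCK hKb g

end Closed

end Literature.MathematicalPhysics.QuantumFieldTheory.Balaban1983to89.B9Eq3126QG1QLowerDiagonalClosed

end
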